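/-
Origin: expansion seat `prover-pub-hodgecm-mc-sinst-1-g11-0`, handover #1266 2026-08-21T03:47Z md5 4db509f76d72 (325 l.; r3 re-stamp: docstring wording only, decls byte-identical to r2 a9b19a58e828; NEW additive leaf, ns HodgeCM.Model.ThetaAdelicSide, = #1254 §2 + #1256 §§2–4 over the G-datum D₀ := thetaDistDatumZeroOfG V c S … η₀ η₁ η₂ η₃ hι h₁W hV hω hη₀c Φarch harm hdef with the slot character η₀ GENERIC: def cVZeroG/cWZeroG/psiZeroG η₀, chiZero_eq_mul_psiZeroG, ωfW_/ωfV_zeroG_finSBReindex, def coinvEquivZeroG (+_mk), coinvRep_coinvEquivZeroG, coinvEquivZeroG_twist_of_eq, def ΩEquivZeroG, iSup_range_coinvRep_zeroG_eq, def dictEquivZeroOfBigCharG; def adelicCharZeroG η₀ := η₀(·,1)·χ₀(·,1) (+_apply), def bigCharZeroG, twistCharV_bigCharZeroG_comp, adelicCharZeroG_eq_one_of_rat (hη₀V : ∀ v ∈ CMRat (frameD V), η₀ (v,1) = 1; + #1256 cmLineChar₀_inl_eq_one_of_rat), bigCharZeroG_isRatTrivial, def splitLineZeroTwistedG, def charZeroDictG,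 def dictEquivZeroCanonicalG, dictEquivZeroCanonicalG_surjective, iSup_range_coinvRep_zeroG_eq_dict; cert rc 0 / 129 s / 0 warn / 0 proof-hole; NAMES for audit: HodgeCM.Model.ThetaAdelicSide.coinvRep_coinvEquivZeroG · HodgeCM.Model.ThetaAdelicSide.bigCharZeroG_isRatTrivial · HodgeCM.Model.ThetaAdelicSide.dictEquivZeroCanonicalG_surjective) (`HOME/mc/pub-hodgecm-mc-sinst-1-g11/stage70/HodgeCM/Model/AdelicThetaSlotZeroBridgeG.lean`, md5 4db509f76d72, 325 lines);
landed by the gen-30 packager (p-g30) in gate run 71 as `HodgeCM/Model/AdelicThetaSlotZeroBridgeG.lean` (verbatim).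
-/
/-
Copyright (c) 2026 the pub-hodgecm formalisation cell (harness21).  New file, not vendored.
Origin: session prover-pub-hodgecm-mc-sinst-1-g11-0 (unit pub-hodgecm-mc-sinst-1-g11, S-INSTANCE CONSTRUCTOR gen 11; the (J4)↔(J3) BRIDGE of
SLOT 0 re-cut ONCE over the pin-agnostic G-datum (lead 1-g84 ROUTING WORD 2026-08-21T02:34:03Z): #1254 § 2 + #1256 with the slot character
`η₀` GENERIC and the side `S` arbitrary — the R2 pin of record is an instance), 2026-08-21.
Intended final place: `HodgeCM/Model/AdelicThetaSlotZeroBridgeG.lean` (NEW additive model-layer leaf; imports sinst-1 #1262 `Model/AdelicThetaDistributionOfG`,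
#1256 `Model/AdelicThetaDistributionBridgeTwist`; nothing imports it yet (the slot-0 automorphy sibling will); drop alone).
-/
import Summits.HodgeConjecture.HodgeCM.Model.AdelicThetaDistributionOfG
import Summits.HodgeConjecture.HodgeCM.Model.AdelicThetaDistributionBridgeTwist

set_option autoImplicit false

/-!
# Slot 0 over the G-datum: the honest module `Ω₀(χ)` is a dictionary carrier at a twisted record, for ANY slot character `η₀` and ANY side

For any side `S` reading back to `lineRepOf … η₀ η₁ η₂ η₃` (`hω`, `hι`) and the G-datum `D₀ := thetaDistDatumZeroOfG … η₀ …` (#1262):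
* § 1 `cVZeroG ∕ cWZeroG ∕ psiZeroG`, `coinvEquivZeroG`, `coinvRep_coinvEquivZeroG`, **`ΩEquivZeroG`**, blocks equal (#1254 § 2b at a generic `η₀`);
* § 2 `adelicCharZeroG η₀ := η₀(·,1) · χ₀(·,1)`, `bigCharZeroG`, `twistCharV_bigCharZeroG_comp`, **`bigCharZeroG_isRatTrivial`** under
  `hη₀V : ∀ v ∈ CMRat (frameD V), η₀ (v, 1) = 1` (+ [Weil1964, Thm 6] for `λ_V′`, #1256 `cmLineChar₀_inl_eq_one_of_rat`), `splitLineZeroTwistedG`,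
  `dictEquivZeroOfBigCharG`, `charZeroDictG`, **`dictEquivZeroCanonicalG`** + `_surjective`, blocks equal (#1256 §§ 2–4 at a generic `η₀`).
At the default split (`η₀ := eta₀ V c.D η`, `S := archSideOf …`) these are #1254 ∕ #1256's objects by `thetaDistDatumZeroOfG_archSideOf`; at the R2 pin
`η₀ := etaT₀ η ν`.  KERNEL only: 0 records, 0 `def … : Prop`, nothing cited as a hypothesis; `#print axioms` ⊆ {propext, Classical.choice, Quot.sound}.
-/

noncomputable section

open MulAction IsDedekindDomain NumberField.mixedEmbedding
open NumberField hiding relNormOneIdeles relNormOneRat probHaarRelNormOneQuot relNormOneInfUnits relNormOneInfToIdeles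
open scoped Matrix TensorProduct Classical SchwartzMap
open Literature.NumberTheory.Automorphic Literature.NumberTheory.Weil1964
open Literature.NumberTheory.GelbartRogawski1991 Literature.NumberTheory.GelbartRogawski1991.UnitaryDualPair
open Literature.RepresentationTheory (SeesawScalar.twist SeesawScalar.twist_apply)
open Literature.Geometry.ComplexHyperbolic.BallModel (U21 x₀)
open Literature.AlgebraicGeometry.ShimuraVarieties
open HodgeCM.Adelic HodgeCM.PerL34 HodgeCM.Model.ArchSideTerm HodgeCM.Model.ThetaDistFin

namespace HodgeCM.Model
namespace ThetaAdelicSide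

variable {L : CMField} {ι₁ : L →+* ℂ} (V : HermSpace3 L ι₁) (c : SeesawCtx L) (S : ThetaAdelicSide V c)
  (hGR : (cmSplittingDatum (L : Type) finProdFinEquiv (frameD V) (frameD_real V) (frameD_ne V) (dW c.D) (dW_real c.D)
    (dW_ne c.D)).CompatibleSplitting)
  (hGR₀ : (cmSplittingDatum (L : Type) (e₁) (frameD V) (frameD_real V) (frameD_ne V) (lineVec (L : Type) (dW c.D 0))
    (fun _ => dW_real c.D 0) (fun _ => dW_ne c.D 0)).CompatibleSplitting)
  (hGR₁ : (cmSplittingDatum (L : Type) (e₁) (frameD V) (frameD_real V) (frameD_ne V) (lineVec (L : Type) (dW c.D 1))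
    (fun _ => dW_real c.D 1) (fun _ => dW_ne c.D 1)).CompatibleSplitting)
  (hGR₂ : (cmSplittingDatum (L : Type) (e₁) (frameD V) (frameD_real V) (frameD_ne V) (lineVec (L : Type) (dW' c.D 0))
    (fun _ => dW'_real c.D 0) (fun _ => dW'_ne c.D 0)).CompatibleSplitting)
  (hGR₃ : (cmSplittingDatum (L : Type) (e₁) (frameD V) (frameD_real V) (frameD_ne V) (lineVec (L : Type) (dW' c.D 1))
    (fun _ => dW'_real c.D 1) (fun _ => dW'_ne c.D 1)).CompatibleSplitting)
  (η₀ η₁ η₂ η₃ : CMAdelic (L : Type) (frameD V) × CMAdelicOne (L : Type) →* ℂˣ)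
  (hι : S.ιinf = archInfOf V)
  (h₁W : (∀ j, 0 < (ι₁ (dW c.D j)).re) ∨ ∀ j, (ι₁ (dW c.D j)).re < 0)
  (hV : IsAnisotropic L V.Hm)
  (hω : (S.P 0).ω = lineRepOf V c.D hGR hGR₀ hGR₁ hGR₂ hGR₃ η₀ η₁ η₂ η₃ 0)
  (hη₀c : Continuous fun p => ((η₀ p : ℂˣ) : ℂ))

/-! ## § 1. The slot-0 characters at a generic `η₀` and the coinvariant comparison -/

/-- **`c_{V,0}(η₀) : k ↦ finCharZero η₀ (k, 1)`** — the `U(V)(𝔸_f)`-part of the slot-0 see-saw character for the slot character `η₀`. -/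
def cVZeroG : ↥V.adelicFin →* ℂˣ :=
  (finCharZero V c.D hGR hGR₀ hGR₁ η₀).comp (MonoidHom.inl _ _)

/-- **`c_{W,0}(η₀) : u ↦ finCharZero η₀ (1, u)`**. -/
def cWZeroG : UfZero c.D →* ℂˣ :=
  (finCharZero V c.D hGR hGR₀ hGR₁ η₀).comp (MonoidHom.inr _ _)

/-- (Ported verbatim from the HodgeCMPerL package; no docstring in the source.) -/
@[simp] theorem cVZeroG_apply (g : ↥V.adelicFin) :
    cVZeroG V c hGR hGR₀ hGR₁ η₀ g = finCharZero V c.D hGR hGR₀ hGR₁ η₀ (g, 1) := rfl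

/-- (Ported verbatim from the HodgeCMPerL package; no docstring in the source.) -/
@[simp] theorem cWZeroG_apply (u : UfZero c.D) :
    cWZeroG V c hGR hGR₀ hGR₁ η₀ u = finCharZero V c.D hGR hGR₀ hGR₁ η₀ (1, u) := rfl

/-- **the untwisted dictionary-side character `ψ₀(η₀, χ) := chiZero χ · c_{W,0}(η₀)⁻¹`**. -/
def psiZeroG (χ : PontryaginDual (↥(relNormOneIdeles (↥(maximalRealSubfield L)) L) ⧸ relNormOneRat (↥(maximalRealSubfield L)) L)) :
    UfZero c.D →* ℂˣ :=
  chiZero c χ * (cWZeroG V c hGR hGR₀ hGR₁ η₀)⁻¹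

/-- (Ported verbatim from the HodgeCMPerL package; no docstring in the source.) -/
theorem chiZero_eq_mul_psiZeroG
    (χ : PontryaginDual (↥(relNormOneIdeles (↥(maximalRealSubfield L)) L) ⧸ relNormOneRat (↥(maximalRealSubfield L)) L))
    (u : UfZero c.D) :
    chiZero c χ u = finCharZero V c.D hGR hGR₀ hGR₁ η₀ (1, u) * psiZeroG V c hGR hGR₀ hGR₁ η₀ χ u := by
  rw [psiZeroG, MonoidHom.mul_apply, MonoidHom.inv_apply, cWZeroG_apply, mul_comm (chiZero c χ u), ← mul_assoc, mul_inv_cancel,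
    one_mul]

section Coinv

variable (Φarch : Module.Dual ℂ (Fin 2 → ℂ) →ₗ[ℂ] 𝓢((Fin 3 → mixedSpace (↥(maximalRealSubfield L))), ℂ))
  (harm : ∀ (u : ↥(stabilizer U21 x₀)) (ℓ : Module.Dual ℂ (Fin 2 → ℂ)),
    lineOmega_zero V c.D hGR hGR₀ hGR₁ η₀ (u : U21) (Φarch ℓ) =
      Φarch ((BallForms.isPullbackCocycle_cotangentCocycle.weightOf x₀).dual u ℓ))
  (hdef : ∀ a : UnitaryGroup.arch (↥(maximalRealSubfield L)) L (IsCMField.complexConj L) 3 V.Hm,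
    UnitaryGroup.archAt (↥(maximalRealSubfield L)) L (IsCMField.complexConj L) 3 V.Hm (UnitaryGroup.cmPlace (L : Type) ι₁)
        (NumberField.complexConj_smul_infinitePlace (L : Type) _) (IsCMField.complexConj_ne_one (L : Type)) a = 1 →
    ∀ (ℓ : Module.Dual ℂ (Fin 2 → ℂ)) (Φf : FinSB (↥(maximalRealSubfield L)) (Fin 3)),
      lineRepOf V c.D hGR hGR₀ hGR₁ hGR₂ hGR₃ η₀ η₁ η₂ η₃ 0
          (HodgeCM.Adelic.regimeEquiv L V.Hm hV
            (UnitaryGroup.archToAdelic (↥(maximalRealSubfield L)) L (IsCMField.complexConj L) 3 V.Hm a), 1)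
          (piSchwartzBruhatEquiv (↥(maximalRealSubfield L)) (Fin 3) (Φarch ℓ ⊗ₜ[ℂ] Φf)) =
        piSchwartzBruhatEquiv (↥(maximalRealSubfield L)) (Fin 3) (Φarch ℓ ⊗ₜ[ℂ] Φf))
  (χ : PontryaginDual (↥(relNormOneIdeles (↥(maximalRealSubfield L)) L) ⧸ relNormOneRat (↥(maximalRealSubfield L)) L))
  (ψ : UfZero c.D →* ℂˣ)
  (hψ : ∀ u : UfZero c.D, chiZero c χ u = finCharZero V c.D hGR hGR₀ hGR₁ η₀ (1, u) * ψ u)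

local notation "D₀" => thetaDistDatumZeroOfG V c S hGR hGR₀ hGR₁ hGR₂ hGR₃ η₀ η₁ η₂ η₃ hι h₁W hV hω hη₀c Φarch harm hdef

/-- (T-W) `ω_{f,W}(u) (R f) = finCharZero η₀ (1, u) • R (finPairRepW splitLineZero.hs u f)` for the G-datum. -/
theorem ωfW_zeroG_finSBReindex (u : UfZero c.D) (f : FinSB (↥(maximalRealSubfield L)) (Fin 3 × Fin 1)) :
    (D₀).ωfW u (finSBReindex (↥(maximalRealSubfield L)) e₁ f) =
      ((finCharZero V c.D hGR hGR₀ hGR₁ η₀ (1, u) : ℂˣ) : ℂ) •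
        finSBReindex (↥(maximalRealSubfield L)) e₁
          (HodgeCM.WeilCoinv.finPairRepW _ _ _ _ _ _ _ _ _ _ _ _ _ _ _ _ _ (splitLineZero V c hGR₀).hs u f) := by
  show finRepZero V c.D hGR hGR₀ hGR₁ η₀ (1, u) _ = _
  rw [finRepZero_apply, map_one, LinearEquiv.symm_apply_apply]
  rfl

/-- (T-V) `ω_{f,V}(g) (R f) = finCharZero η₀ (g, 1) • R (finPairRepV splitLineZero.hs (finFrameCongr g) f)` for the G-datum. -/
theorem ωfV_zeroG_finSBReindex (g : ↥V.adelicFin) (f : FinSB (↥(maximalRealSubfield L)) (Fin 3 × Fin 1)) :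
    (D₀).ωfV g (finSBReindex (↥(maximalRealSubfield L)) e₁ f) =
      ((finCharZero V c.D hGR hGR₀ hGR₁ η₀ (g, 1) : ℂˣ) : ℂ) •
        finSBReindex (↥(maximalRealSubfield L)) e₁
          (HodgeCM.WeilCoinv.finPairRepV _ _ _ _ _ _ _ _ _ _ _ _ _ _ _ _ _ (splitLineZero V c hGR₀).hs
            (finFrameCongr (L : Type) V.Hm (frameG V) (frameD V) (frame_congr V) g) f) := by
  show finRepZero V c.D hGR hGR₀ hGR₁ η₀ (g, 1) _ = _
  rw [finRepZero_apply, LinearEquiv.symm_apply_apply]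
  rfl

/-- **THE COINVARIANT COMPARISON OF SLOT 0 (G-datum)**: `Coinv (finPairRepW splitLineZero.hs) ψ ≃ₗ[ℂ] Coinv ω_{f,W} (chiFin χ)` whenever
`chiZero χ = finCharZero η₀ (1, ·) · ψ`. -/
def coinvEquivZeroG :
    TwistedCoinv.Coinv (HodgeCM.WeilCoinv.finPairRepW _ _ _ _ _ _ _ _ _ _ _ _ _ _ _ _ _ (splitLineZero V c hGR₀).hs) ψ ≃ₗ[ℂ]
      TwistedCoinv.Coinv (D₀).ωfW ((D₀).chiFin χ) :=
  TwistedCoinv.mapEquiv _ ψ _ _ (finSBReindex (↥(maximalRealSubfield L)) e₁) (fun u => finCharZero V c.D hGR hGR₀ hGR₁ η₀ (1, u))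
    (fun u f => ωfW_zeroG_finSBReindex V c S hGR hGR₀ hGR₁ hGR₂ hGR₃ η₀ η₁ η₂ η₃ hι h₁W hV hω hη₀c Φarch harm hdef u f) hψ

/-- (Ported verbatim from the HodgeCMPerL package; no docstring in the source.) -/
@[simp] theorem coinvEquivZeroG_mk (f : FinSB (↥(maximalRealSubfield L)) (Fin 3 × Fin 1)) :
    coinvEquivZeroG V c S hGR hGR₀ hGR₁ hGR₂ hGR₃ η₀ η₁ η₂ η₃ hι h₁W hV hω hη₀c Φarch harm hdef χ ψ hψ (TwistedCoinv.mk _ ψ f) =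
      TwistedCoinv.mk _ _ (finSBReindex (↥(maximalRealSubfield L)) e₁ f) := rfl

/-- **THE INTERTWINING LAW (G-datum)**: `Ω₀(χ)(g) (E x) = finCharZero η₀ (g, 1) • E (Ω(splitLineZero, ψ)(finFrameCongr g) x)`. -/
theorem coinvRep_coinvEquivZeroG (g : ↥V.adelicFin)
    (x : TwistedCoinv.Coinv (HodgeCM.WeilCoinv.finPairRepW _ _ _ _ _ _ _ _ _ _ _ _ _ _ _ _ _ (splitLineZero V c hGR₀).hs) ψ) :
    (D₀).coinvRep χ g (coinvEquivZeroG V c S hGR hGR₀ hGR₁ hGR₂ hGR₃ η₀ η₁ η₂ η₃ hι h₁W hV hω hη₀c Φarch harm hdef χ ψ hψ x) =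
      ((finCharZero V c.D hGR hGR₀ hGR₁ η₀ (g, 1) : ℂˣ) : ℂ) •
        coinvEquivZeroG V c S hGR hGR₀ hGR₁ hGR₂ hGR₃ η₀ η₁ η₂ η₃ hι h₁W hV hω hη₀c Φarch harm hdef χ ψ hψ
          (HodgeCM.WeilCoinv.weilCoinv _ _ _ _ _ _ _ _ _ _ _ _ _ _ _ _ _ ψ (splitLineZero V c hGR₀).hs
            (finFrameCongr (L : Type) V.Hm (frameG V) (frameD V) (frame_congr V) g) x) :=
  TwistedCoinv.mapEquiv_rep _ ψ _ _
    (HodgeCM.WeilCoinv.finPairRepV _ _ _ _ _ _ _ _ _ _ _ _ _ _ _ _ _ (splitLineZero V c hGR₀).hs) _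
    (HodgeCM.WeilCoinv.commute_finPairRepV_finPairRepW _ _ _ _ _ _ _ _ _ _ _ _ _ _ _ _ _ (splitLineZero V c hGR₀).hs)
    (D₀).commute_ωfV_ωfW _ _ _ hψ
    (fun f => ωfV_zeroG_finSBReindex V c S hGR hGR₀ hGR₁ hGR₂ hGR₃ η₀ η₁ η₂ η₃ hι h₁W hV hω hη₀c Φarch harm hdef g f) x

/-- the same law against the `c_{V,0}(η₀)`-twisted pullback. -/
theorem coinvEquivZeroG_twist_of_eq (cV : ↥V.adelicFin →* ℂˣ) (hcV : cV = cVZeroG V c hGR hGR₀ hGR₁ η₀) (g : ↥V.adelicFin)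
    (x : TwistedCoinv.Coinv (HodgeCM.WeilCoinv.finPairRepW _ _ _ _ _ _ _ _ _ _ _ _ _ _ _ _ _ (splitLineZero V c hGR₀).hs) ψ) :
    coinvEquivZeroG V c S hGR hGR₀ hGR₁ hGR₂ hGR₃ η₀ η₁ η₂ η₃ hι h₁W hV hω hη₀c Φarch harm hdef χ ψ hψ
        (SeesawScalar.twist cV
          ((HodgeCM.WeilCoinv.weilCoinv _ _ _ _ _ _ _ _ _ _ _ _ _ _ _ _ _ ψ (splitLineZero V c hGR₀).hs).comp
            (finFrameCongr (L : Type) V.Hm (frameG V) (frameD V) (frame_congr V))) g x) =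
      (D₀).coinvRep χ g (coinvEquivZeroG V c S hGR hGR₀ hGR₁ hGR₂ hGR₃ η₀ η₁ η₂ η₃ hι h₁W hV hω hη₀c Φarch harm hdef χ ψ hψ x) := by
  subst hcV
  rw [SeesawScalar.twist_apply, coinvRep_coinvEquivZeroG]
  exact map_smul (coinvEquivZeroG V c S hGR hGR₀ hGR₁ hGR₂ hGR₃ η₀ η₁ η₂ η₃ hι h₁W hV hω hη₀c Φarch harm hdef χ ψ hψ) _ _

include hψ in
/-- **THE BRIDGE OF SLOT 0 (G-datum), module currency**: `(twist c_{V,0}(η₀) (Ω(splitLineZero, ψ) ∘ finFrameCongr)).asModule ≃ₗ[ℂ[U(V)(𝔸_f)]]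
Ω₀(χ)`. -/
def ΩEquivZeroG :
    (SeesawScalar.twist (cVZeroG V c hGR hGR₀ hGR₁ η₀)
          ((HodgeCM.WeilCoinv.weilCoinv _ _ _ _ _ _ _ _ _ _ _ _ _ _ _ _ _ ψ (splitLineZero V c hGR₀).hs).comp
            (finFrameCongr (L : Type) V.Hm (frameG V) (frameD V) (frame_congr V)))).asModule ≃ₗ[adelicAlgebra V]
      ((D₀).coinvRep χ).asModule :=
  EquivariantLift.liftEquiv _ _ (coinvEquivZeroG V c S hGR hGR₀ hGR₁ hGR₂ hGR₃ η₀ η₁ η₂ η₃ hι h₁W hV hω hη₀c Φarch harm hdef χ ψ hψ)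
    (coinvEquivZeroG_twist_of_eq V c S hGR hGR₀ hGR₁ hGR₂ hGR₃ η₀ η₁ η₂ η₃ hι h₁W hV hω hη₀c Φarch harm hdef χ ψ hψ _ rfl)

include hψ in
/-- **BLOCKS EQUAL (slot 0, G-datum)**. -/
theorem iSup_range_coinvRep_zeroG_eq {T : Type*} [AddCommMonoid T] [Module ℂ T] [Module (adelicAlgebra V) T]
    [IsScalarTower ℂ (adelicAlgebra V) T] :
    (⨆ f : ((D₀).coinvRep χ).asModule →ₗ[adelicAlgebra V] T, (LinearMap.range f).restrictScalars ℂ) =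
      ⨆ f : (SeesawScalar.twist (cVZeroG V c hGR hGR₀ hGR₁ η₀)
          ((HodgeCM.WeilCoinv.weilCoinv _ _ _ _ _ _ _ _ _ _ _ _ _ _ _ _ _ ψ (splitLineZero V c hGR₀).hs).comp
            (finFrameCongr (L : Type) V.Hm (frameG V) (frameD V) (frame_congr V)))).asModule →ₗ[adelicAlgebra V] T,
        (LinearMap.range f).restrictScalars ℂ :=
  (EquivariantLift.iSup_range_eq_of_equiv
    (ΩEquivZeroG V c S hGR hGR₀ hGR₁ hGR₂ hGR₃ η₀ η₁ η₂ η₃ hι h₁W hV hω hη₀c Φarch harm hdef χ ψ hψ)).symm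

/-! ## § 2. The twisted record of slot 0 (for a generic `η₀` the `V`-part `c_{V,0}(η₀) = η₀(·, 1)` need not be trivial) -/

variable (ĉ : (splitLineZero V c hGR₀).BigChar) (hĉ : (splitLineZero V c hGR₀).IsRatTrivial ĉ)
  (hĉV : (HodgeCM.WeilCoinv.twistCharV (↥(maximalRealSubfield L)) (L : Type) (IsCMField.complexConj L) 3 1
      (Matrix.diagonal (frameD V)) (splitLineZero V c hGR₀).JW ĉ).comp
        (finFrameCongr (L : Type) V.Hm (frameG V) (frameD V) (frame_congr V)) = cVZeroG V c hGR hGR₀ hGR₁ η₀)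
  (χ'' : (splitLineZero V c hGR₀).CharW)
  (hχ'' : ∀ u, χ'' u =
    HodgeCM.WeilCoinv.twistCharW (↥(maximalRealSubfield L)) (L : Type) (IsCMField.complexConj L) 3 1
      (Matrix.diagonal (frameD V)) (splitLineZero V c hGR₀).JW ĉ u * ψ u)

include hψ hĉV in
/-- **SLOT 0 LANDS IN THE DICTIONARY THROUGH A TWISTED RECORD**: for a rationally trivial big character `ĉ` of `splitLineZero` with `V`-part
`c_{V,0}(η₀)` along `finFrameCongr` and `χ″ = twistCharW ĉ · ψ`, `Ω(splitLineZero ⊗ ĉ, χ″) ≃ₗ[ℂ[U(V)(𝔸_f)]] Ω₀(χ)`. -/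
def dictEquivZeroOfBigCharG :
    ((splitLineZero V c hGR₀).twistBy ĉ hĉ).Ω (finFrameCongr (L : Type) V.Hm (frameG V) (frameD V) (frame_congr V)) χ''
      ≃ₗ[adelicAlgebra V] ((D₀).coinvRep χ).asModule :=
  ((splitLineZero V c hGR₀).ΩTwistByEquiv (finFrameCongr (L : Type) V.Hm (frameG V) (frameD V) (frame_congr V)) ĉ hĉ hχ'').trans
    (EquivariantLift.liftEquiv _ _ (coinvEquivZeroG V c S hGR hGR₀ hGR₁ hGR₂ hGR₃ η₀ η₁ η₂ η₃ hι h₁W hV hω hη₀c Φarch harm hdef χ ψ hψ)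
      (coinvEquivZeroG_twist_of_eq V c S hGR hGR₀ hGR₁ hGR₂ hGR₃ η₀ η₁ η₂ η₃ hι h₁W hV hω hη₀c Φarch harm hdef χ ψ hψ _ hĉV))

end Coinv

/-! ### § 2a. The big character of slot 0 -/

/-- **the adelic `V`-character of slot 0**: `v ↦ η₀(v, 1) · χ₀(v, 1)` on `U(diag frameD V)(𝔸)` (`χ₀(v,1) = λ₄(1) = 1`, kept for symmetry). -/
def adelicCharZeroG : CMAdelic (L : Type) (frameD V) →* ℂˣ :=
  η₀.comp (MonoidHom.inl _ _) *
    (cmLineChar₀ (L : Type) finProdFinEquiv e₁ (frameD V) (frameD_real V) (frameD_ne V) (dW c.D) (dW_real c.D) (dW_ne c.D) hGR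
        hGR₀ hGR₁).comp (MonoidHom.inl _ _)

/-- (Ported verbatim from the HodgeCMPerL package; no docstring in the source.) -/
@[simp] theorem adelicCharZeroG_apply (v : CMAdelic (L : Type) (frameD V)) :
    adelicCharZeroG V c hGR hGR₀ hGR₁ η₀ v =
      η₀ (v, 1) *
        cmLineChar₀ (L : Type) finProdFinEquiv e₁ (frameD V) (frameD_real V) (frameD_ne V) (dW c.D) (dW_real c.D) (dW_ne c.D) hGR
          hGR₀ hGR₁ (v, 1) := rfl


/-- **THE BIG CHARACTER OF SLOT 0**: `ĉ₀(η₀) := adelicCharZeroG η₀ ∘ (G₁(𝔸) ≃ U(diag frameD V)(𝔸))` (#1255 `LinePair.bigCharOfV`). -/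
def bigCharZeroG : (splitLineZero V c hGR₀).BigChar :=
  LinePair.bigCharOfV (↥(maximalRealSubfield L)) (L : Type) (IsCMField.complexConj L) 3 (Matrix.diagonal (frameD V))
    (Matrix.diagonal (lineVec (L : Type) (dW c.D 0))) (lineVec_dW_zero_ne c) (adelicCharZeroG V c hGR hGR₀ hGR₁ η₀)

/-- **its `V`-part along `finFrameCongr` is `c_{V,0}(η₀)`**. -/
theorem twistCharV_bigCharZeroG_comp :
    (HodgeCM.WeilCoinv.twistCharV (↥(maximalRealSubfield L)) (L : Type) (IsCMField.complexConj L) 3 1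
          (Matrix.diagonal (frameD V)) (splitLineZero V c hGR₀).JW (bigCharZeroG V c hGR hGR₀ hGR₁ η₀)).comp
        (finFrameCongr (L : Type) V.Hm (frameG V) (frameD V) (frame_congr V)) =
      cVZeroG V c hGR hGR₀ hGR₁ η₀ := by
  ext g : 1
  rw [MonoidHom.comp_apply, cVZeroG_apply, finCharZero_apply, finPairD_apply, map_one, map_one]
  show (HodgeCM.WeilCoinv.twistCharV (↥(maximalRealSubfield L)) (L : Type) (IsCMField.complexConj L) 3 1
      (Matrix.diagonal (frameD V)) (Matrix.diagonal (lineVec (L : Type) (dW c.D 0))) (bigCharZeroG V c hGR hGR₀ hGR₁ η₀)) _ = _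
  rw [bigCharZeroG, LinePair.twistCharV_bigCharOfV, MonoidHom.comp_apply, adelicCharZeroG_apply]
  rfl

/-! ### § 2b. Rational triviality of `ĉ₀(η₀)` -/

variable (hη₀V : ∀ v ∈ CMRat (L : Type) (frameD V), η₀ (v, 1) = 1)

include hη₀V in
/-- **`adelicCharZeroG η₀ = 1` on `U(diag frameD V)(L⁺)`** under the ONE hypothesis `hη₀V` (the slot character's `V`-part is automorphic). -/
theorem adelicCharZeroG_eq_one_of_rat {v : CMAdelic (L : Type) (frameD V)} (hv : v ∈ CMRat (L : Type) (frameD V)) :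
    adelicCharZeroG V c hGR hGR₀ hGR₁ η₀ v = 1 := by
  rw [adelicCharZeroG_apply, cmLineChar₀_inl_eq_one_of_rat V c hGR hGR₀ hGR₁ hv, mul_one, hη₀V v hv]

include hη₀V in
/-- **`ĉ₀(η₀)` IS RATIONALLY TRIVIAL**. -/
theorem bigCharZeroG_isRatTrivial : (splitLineZero V c hGR₀).IsRatTrivial (bigCharZeroG V c hGR hGR₀ hGR₁ η₀) := fun γ₀ =>
  LinePair.bigCharOfV_rationalPairToAdelic' _ _ _ _ _ _ _ _ (fun _ hv => adelicCharZeroG_eq_one_of_rat V c hGR hGR₀ hGR₁ η₀ hη₀V hv) γ₀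

/-- **THE TWISTED INDEX RECORD OF SLOT 0**: `splitLineZero ⊗ ĉ₀(η₀)`. -/
def splitLineZeroTwistedG :
    SplitLine (Matrix.diagonal (frameD V)) (realDiagonal (L : Type) (frameD V) (frameD_real V))
      (complexConj_imagUnit (L : Type)) (imagUnit_ne_zero (L : Type)) (imagUnit_mul_self (L : Type))
      (realDiagonal_isSymm (L : Type) (frameD V) (frameD_real V))
      (isUnit_det_realDiagonal (L : Type) (frameD V) (frameD_real V) (frameD_ne V))
      (realDiagonal_map (L : Type) (frameD V) (frameD_real V)).symm :=
  (splitLineZero V c hGR₀).twistBy (bigCharZeroG V c hGR hGR₀ hGR₁ η₀) (bigCharZeroG_isRatTrivial V c hGR hGR₀ hGR₁ η₀ hη₀V)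

/-- **the canonical dictionary character of slot 0 at `(η₀, χ)`**: `χ″₀ := twistCharW ĉ₀(η₀) · ψ₀(η₀, χ)`. -/
def charZeroDictG (χ : PontryaginDual (↥(relNormOneIdeles (↥(maximalRealSubfield L)) L) ⧸ relNormOneRat (↥(maximalRealSubfield L)) L)) :
    (splitLineZero V c hGR₀).CharW :=
  HodgeCM.WeilCoinv.twistCharW (↥(maximalRealSubfield L)) (L : Type) (IsCMField.complexConj L) 3 1
      (Matrix.diagonal (frameD V)) (splitLineZero V c hGR₀).JW (bigCharZeroG V c hGR hGR₀ hGR₁ η₀) *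
    (show (splitLineZero V c hGR₀).CharW from psiZeroG V c hGR hGR₀ hGR₁ η₀ χ)

section Canonical

variable (Φarch : Module.Dual ℂ (Fin 2 → ℂ) →ₗ[ℂ] 𝓢((Fin 3 → mixedSpace (↥(maximalRealSubfield L))), ℂ))
  (harm : ∀ (u : ↥(stabilizer U21 x₀)) (ℓ : Module.Dual ℂ (Fin 2 → ℂ)),
    lineOmega_zero V c.D hGR hGR₀ hGR₁ η₀ (u : U21) (Φarch ℓ) =
      Φarch ((BallForms.isPullbackCocycle_cotangentCocycle.weightOf x₀).dual u ℓ))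
  (hdef : ∀ a : UnitaryGroup.arch (↥(maximalRealSubfield L)) L (IsCMField.complexConj L) 3 V.Hm,
    UnitaryGroup.archAt (↥(maximalRealSubfield L)) L (IsCMField.complexConj L) 3 V.Hm (UnitaryGroup.cmPlace (L : Type) ι₁)
        (NumberField.complexConj_smul_infinitePlace (L : Type) _) (IsCMField.complexConj_ne_one (L : Type)) a = 1 →
    ∀ (ℓ : Module.Dual ℂ (Fin 2 → ℂ)) (Φf : FinSB (↥(maximalRealSubfield L)) (Fin 3)),
      lineRepOf V c.D hGR hGR₀ hGR₁ hGR₂ hGR₃ η₀ η₁ η₂ η₃ 0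
          (HodgeCM.Adelic.regimeEquiv L V.Hm hV
            (UnitaryGroup.archToAdelic (↥(maximalRealSubfield L)) L (IsCMField.complexConj L) 3 V.Hm a), 1)
          (piSchwartzBruhatEquiv (↥(maximalRealSubfield L)) (Fin 3) (Φarch ℓ ⊗ₜ[ℂ] Φf)) =
        piSchwartzBruhatEquiv (↥(maximalRealSubfield L)) (Fin 3) (Φarch ℓ ⊗ₜ[ℂ] Φf))
  (χ : PontryaginDual (↥(relNormOneIdeles (↥(maximalRealSubfield L)) L) ⧸ relNormOneRat (↥(maximalRealSubfield L)) L))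

local notation "D₀" => thetaDistDatumZeroOfG V c S hGR hGR₀ hGR₁ hGR₂ hGR₃ η₀ η₁ η₂ η₃ hι h₁W hV hω hη₀c Φarch harm hdef

/-- **SLOT 0, CANONICAL FORM (G-datum)**: `Ω(splitLineZero ⊗ ĉ₀(η₀), χ″₀) ≃ₗ[ℂ[U(V)(𝔸_f)]] Ω₀(χ)` — the index pair
`(splitLineZeroTwistedG, charZeroDictG χ)` of axioms-1's dictionary at `ιVE V = finFrameCongr` carries EXACTLY the honest slot-0 module of the
G-datum, at every pin. -/
def dictEquivZeroCanonicalG :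
    (splitLineZeroTwistedG V c hGR hGR₀ hGR₁ η₀ hη₀V).Ω (finFrameCongr (L : Type) V.Hm (frameG V) (frameD V) (frame_congr V))
        (charZeroDictG V c hGR hGR₀ hGR₁ η₀ χ) ≃ₗ[adelicAlgebra V] ((D₀).coinvRep χ).asModule :=
  dictEquivZeroOfBigCharG V c S hGR hGR₀ hGR₁ hGR₂ hGR₃ η₀ η₁ η₂ η₃ hι h₁W hV hω hη₀c Φarch harm hdef χ
    (psiZeroG V c hGR hGR₀ hGR₁ η₀ χ) (chiZero_eq_mul_psiZeroG V c hGR hGR₀ hGR₁ η₀ χ) _ _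
    (twistCharV_bigCharZeroG_comp V c hGR hGR₀ hGR₁ η₀) (charZeroDictG V c hGR hGR₀ hGR₁ η₀ χ) fun _ => rfl

/-- hence the `adelicAlgebra V`-linear SURJECTION binder-2's block socket (#101 ∕ #102) consumes, slot 0, any pin. -/
theorem dictEquivZeroCanonicalG_surjective :
    Function.Surjective (dictEquivZeroCanonicalG V c S hGR hGR₀ hGR₁ hGR₂ hGR₃ η₀ η₁ η₂ η₃ hι h₁W hV hω hη₀c hη₀V Φarch harm hdef χ) :=
  (dictEquivZeroCanonicalG V c S hGR hGR₀ hGR₁ hGR₂ hGR₃ η₀ η₁ η₂ η₃ hι h₁W hV hω hη₀c hη₀V Φarch harm hdef χ).surjective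

/-- **BLOCKS EQUAL (slot 0, dictionary currency, G-datum)**. -/
theorem iSup_range_coinvRep_zeroG_eq_dict {T : Type*} [AddCommMonoid T] [Module ℂ T] [Module (adelicAlgebra V) T]
    [IsScalarTower ℂ (adelicAlgebra V) T] :
    (⨆ f : ((D₀).coinvRep χ).asModule →ₗ[adelicAlgebra V] T, (LinearMap.range f).restrictScalars ℂ) =
      ⨆ f : (splitLineZeroTwistedG V c hGR hGR₀ hGR₁ η₀ hη₀V).Ω (finFrameCongr (L : Type) V.Hm (frameG V) (frameD V) (frame_congr V))
          (charZeroDictG V c hGR hGR₀ hGR₁ η₀ χ) →ₗ[adelicAlgebra V] T, (LinearMap.range f).restrictScalars ℂ :=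
  (EquivariantLift.iSup_range_eq_of_equiv
    (dictEquivZeroCanonicalG V c S hGR hGR₀ hGR₁ hGR₂ hGR₃ η₀ η₁ η₂ η₃ hι h₁W hV hω hη₀c hη₀V Φarch harm hdef χ)).symm

end Canonical

end ThetaAdelicSide
end HodgeCM.Model

end
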